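import Literature.IUT.HodgeArakelov.StableCurveAgreementPiDictionaryGenuine
import HarnessLib

/-!
# [IUTchII] Def 2.3 (i): the Δ-level `ℍ`-dictionary `SubgraphDictionary` AT THE GENUINE AGREEMENT `ofPiCHat ↔ ofSpecialFibre`

S. Mochizuki, *Inter-universal Teichmüller Theory II*, kurims manuscript (Dec. 2020), §2, Def 2.3 (i) p. 67 («`Π^±_v := Π^tp_{X_v}`,
`Π̂^±_v := Π̂_{X_v}`», «`Π^±_{v▶} := N_{Π^±_v}(Π_{v▶})`», «`Δ^±_{v▶} := Π^±_{v▶} ∩ Δ̂^±_v`» [cf. [IUTchI], Corollary 2.3, (iii), (iv)]);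
*Inter-universal Teichmüller Theory I* (May 2020), §2, Cor 2.3 (iii)(iv) pp. 47–48 [cite: Mochizuki2012, II Def 2.3 (i) p.67;
I Cor 2.3 (iii)(iv) pp.47–48] (D-0012 claim key, status disputed; every printed statement of the series is a HYPOTHESIS named by the
tree's predicates — nothing of the series is asserted).  abc-iut cell, seat abc-iut-f-120 (gen 7), L6 ROWS #4 register row **LF6-50**
(frozen FACT-LIST row **F-2734** `PlusMinusTower.StableCurveAgreement.SubgraphDictionary`).  PROOF-ONLY companion of abc-iut-L6-t7's
`PlusMinusTowerStableCurveBridge.lean` (the decl) and abc-iut-w5-d132's `StableCurveAgreementPiDictionaryGenuine.lean` (the genuine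
Π-level producer): no `def`, no `structure`, no `instance`, nothing re-typed.

THE POINT.  F-2734 is a SCHEMA (universal closure REFUTED: `not_forall_subgraphDictionary`, p457711) whose content is its instance
forms.  The tree's GENUINE producer `PlusMinusTower.exists_stableCurveAgreement_piSubgraphDictionary_ofPiCHat_ofSpecialFibre` (p437935)
stops at the Π-LEVEL dictionary `A.PiSubgraphDictionary H▶` («`Π^±_{v▶} = Π^tp_{X̲_v,ℍ}`»); the Δ-LEVEL dictionary of record
`A.SubgraphDictionary H▶` («`Δ^±_{v▶} = Δ^tp_{X̲_v,ℍ}`» — the decl F-2734, the hypothesis `Dic` of abc-iut-L6-t7's `StableCurveAgreement.h23v`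
and of the Cor 2.4 (i) assembly) was reached only INSIDE proofs (via `subgraphDictionary_comap` / `SubgraphDictionary.of_pi`), so no
kernel theorem concluded in the decl at the genuine agreement.  This file names that theorem:

* **`PlusMinusTower.exists_stableCurveAgreement_subgraphDictionary_ofPiCHat_ofSpecialFibre`** — at abc-iut-L6-t19's GENUINE `±`-tower
  `ofPiCHat` and abc-iut-L5's GENUINE [IUTchI] §2 datum `ofSpecialFibre` of `X̲_v` (setting and binders of p437935 VERBATIM, plus [IUTchI]
  Cor 2.3 (iii) of that datum BY NAME): ∃ `Cu` `A` with `eHat` bicontinuous, `eHat ∘ emb = ιX ∘ plainIso`, the level clause, the Π-level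
  dictionary AND **`A.SubgraphDictionary H▶`** at `H▶ := incl⁻¹(plainIso⁻¹ Π^tp_{X̲_v,ℍ})`.  PROVED (p437935 ∘ `SubgraphDictionary.of_pi`).
* **`PlusMinusTower.exists_stableCurveAgreement_h23v_ofPiCHat_ofSpecialFibre`** — the same agreement delivers hypothesis `h23v` of
  abc-iut-w4-d012's `cor24_i_of_inputs` at `H▶` («`γ' ∈ Δ̂^±_{v▶}` ⟹ `γ' ∈ Δ^±_{v▶}` [cf. [IUTchI], Corollary 2.3, (v)]», [IUTchII] Cor 2.4 (i)
  proof p. 71), given in addition [IUTchI] Cor 2.3 (ii), (v) of the datum BY NAME.  PROVED (∘ abc-iut-L6-t7's `StableCurveAgreement.h23v`).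

RESIDUAL BY NAME (displayed, never asserted): the special-fibre DATA of `X̲_v` (`hDopen`, `d`, `Sf`, `h36`, `Σ ⊆ Σ̂`, `Π^tp_ℍ ≤ Π̂_ℍ`,
`cuspMeetsH`), the tower binders `hZ`, `hN`, and the L5 NODES [IUTchI] Cor 2.3 (iii), (iv) (resp. also (ii), (v)) of that datum under its
`Cor23Hyp` — abc-iut-L5's `StableCurveTemperedData.Cor23iii/Cor23iv/Cor23ii/Cor23v` (closers of record at the special fibre:
`cor23iv_ofSpecialFibre_of_slim`, `cor23_i_to_v_ofSpecialFibre_closureH_of_piData_of_mem_decompSubgroups_of_hPrime` p485924, with THEIR named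
residuals).  HONEST LABEL: GENUINE on both sides modulo those binders; an instance-form theorem at OUR model is not the print universal
closure; nothing of the series is asserted; no side taken on [IUTchIII] Cor 3.12; typed ≠ proved; nothing here asserts abc proved or refuted.
-/

noncomputable section

namespace Literature.IUT.HodgeArakelov

open Literature.AnabelianGeometry.EtaleTheta Literature.AnabelianGeometry.SemiGraphs Literature.IUT.HodgeTheaters
open scoped Pointwise

universe u

namespace PlusMinusTower

section Genuine

variable {p : ℕ} [Fact p.Prime] {M : MuTwoSetting p} (e : M.CLevelData)
  {E : M.toThetaSetting.EtaleThetaData} {l : ℕ} (C : E.DoubleUnderline l) {N : ℕ+}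
  (μ : M.toThetaSetting.CyclotomeMod l N) (hC : M.toThetaSetting.Compat) (hS : M.toThetaSetting.Sec2Hyps)
  (hl : l.Prime) (hp2 : p ≠ 2) (hpl : p ≠ l) (hζ : ∃ ζ : M.toThetaSetting.K, IsPrimitiveRoot ζ (4 * l))
  {η : (C.thetaEnvData μ hC hS).PiYdd → MuN p N} (hη : η ∈ (C.thetaEnvData μ hC hS).thetaCocycles)
  (hZ : Thm16Sub.KerToZIsCompactlyGenerated M.toThetaSetting) (hN : (C.Huu.subgroupOf (M.GtpXu l)).Normal)
  {P : TopGroup.{0}} (T : TemperedCoverings (BadPlaceSetting.ofUnderline C μ hC hS hl hp2 hpl hζ hη) P)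

/-- **[IUTchII] Def 2.3 (i) — THE Δ-LEVEL `ℍ`-DICTIONARY (FACT-LIST row F-2734, decl of record) AT THE GENUINE AGREEMENT** (abc-iut-L6-t19's
GENUINE `±`-tower `ofPiCHat` ↔ abc-iut-L5's GENUINE [IUTchI] §2 datum `ofSpecialFibre` of the curve `X̲_v`; the setting and binders of
abc-iut-w5-d132's `exists_stableCurveAgreement_piSubgraphDictionary_ofPiCHat_ofSpecialFibre` (p437935) VERBATIM, plus [IUTchI] Cor 2.3 (iii) of
the datum BY NAME).  There are a cuspidal datum `Cu` and an agreement `A` with `eHat ∘ emb = ιX ∘ plainIso`, `eHat` BICONTINUOUS, the level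
clause, the Π-level dictionary `A.PiSubgraphDictionary H▶` and — the new conjunct — the Δ-level dictionary **`A.SubgraphDictionary H▶`**
(«`Δ^±_{v▶} := Π^±_{v▶} ∩ Δ̂^±_v` is carried by `eHat` onto `Δ^tp_{X̲_v,ℍ} ↪ Δ̂_{X̲_v}` [cf. [IUTchI], Corollary 2.3, (iii), (iv)]») at the
decomposition subgroup `H▶ := incl⁻¹(plainIso⁻¹ Π^tp_{X̲_v,ℍ})` («`Π_{v▶} := Π_v ∩ Π^tp_{X̲_v,ℍ}`»).  PROVED (p437935 composed with
abc-iut-L6-t7's `SubgraphDictionary.of_pi`).  HONEST LABEL: GENUINE on both sides modulo the binders named in the signature (`hZ`, `hN`,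
`hDopen`, the special-fibre DATA of `X̲_v`, [IUTchI] Cor 2.3 (iii), (iv) for it under `Cor23Hyp`); nothing of the series is asserted; no side
taken on [IUTchIII] Cor 3.12. ([IUTchII] Def 2.3 (i), kurims p.67; [IUTchI] Cor 2.3 (iii)(iv), kurims pp.47–48)
[claim: Mochizuki2012, status: disputed] -/
theorem exists_stableCurveAgreement_subgraphDictionary_ofPiCHat_ofSpecialFibre [(M.GtpXu l).FiniteIndex]
    [FiniteDimensional ℚ_[p] M.K]
    (hDopen : ∀ (x : M.toTemperedCurve.Pt) (g : M.toTemperedCurve.PiTemp),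
      IsOpen (M.toTemperedCurve.aug '' ((M.toTemperedCurve.decompOfOpenAt (M.GtpXu l) x g).map (M.GtpXu l).subtype :
        Set M.toTemperedCurve.PiTemp)))
    (d : (M.toTemperedCurve.ofOpenSubgroup (M.GtpXu l) (M.toThetaSetting.isOpen_GtpXu l) M.K (range_aug_GtpXu_eq_GK C) hDopen).GroupLevelData)
    (Sf : SpecialFibreData ((M.toTemperedCurve.ofOpenSubgroup (M.GtpXu l) (M.toThetaSetting.isOpen_GtpXu l) M.K (range_aug_GtpXu_eq_GK C) hDopen).toTemperedArithmeticGroup d))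
    (h36 : Sf.Gc.Prop36Hypotheses) (Sigma SigmaHat : Set ℕ) (hsub : Sigma ⊆ SigmaHat) (hne : Sigma.Nonempty)
    (hprime : ∀ q ∈ SigmaHat, q.Prime) (hp : p ∉ Sigma) (TpH : Subgroup Sf.chart.G)
    (HatH : Subgroup (TemperedGraphGroupData.exists_completion_of_prop36 Sf.Gc h36 Sf.chart).choose)
    (hle : TpH.map (TemperedGraphGroupData.exists_completion_of_prop36 Sf.Gc h36 Sf.chart).choose_spec.choose.toMonoidHom ≤ HatH)
    (cuspMeetsH : {x : (M.toTemperedCurve.ofOpenSubgroup (M.GtpXu l) (M.toThetaSetting.isOpen_GtpXu l) M.K (range_aug_GtpXu_eq_GK C) hDopen).Pt // (M.toTemperedCurve.ofOpenSubgroup (M.GtpXu l) (M.toThetaSetting.isOpen_GtpXu l) M.K (range_aug_GtpXu_eq_GK C) hDopen).IsCusp x} → Prop)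
    (hHyp : (StableCurveTemperedData.ofSpecialFibre (M.toTemperedCurve.ofOpenSubgroup (M.GtpXu l) (M.toThetaSetting.isOpen_GtpXu l) M.K (range_aug_GtpXu_eq_GK C) hDopen) d Sf h36 Sigma SigmaHat hsub hne hprime hp TpH HatH hle cuspMeetsH).Cor23Hyp)
    (h23iii : (StableCurveTemperedData.ofSpecialFibre (M.toTemperedCurve.ofOpenSubgroup (M.GtpXu l) (M.toThetaSetting.isOpen_GtpXu l) M.K (range_aug_GtpXu_eq_GK C) hDopen) d Sf h36 Sigma SigmaHat hsub hne hprime hp TpH HatH hle cuspMeetsH).Cor23iii)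
    (h23iv : (StableCurveTemperedData.ofSpecialFibre (M.toTemperedCurve.ofOpenSubgroup (M.GtpXu l) (M.toThetaSetting.isOpen_GtpXu l) M.K (range_aug_GtpXu_eq_GK C) hDopen) d Sf h36 Sigma SigmaHat hsub hne hprime hp TpH HatH hle cuspMeetsH).Cor23iv) :
    ∃ (Cu : CuspidalInertiaData (ofPiCHat e C μ hC hS hl hp2 hpl hζ hη hZ hN T)) (A : StableCurveAgreement (ofPiCHat e C μ hC hS hl hp2 hpl hζ hη hZ hN T) Cu (StableCurveTemperedData.ofSpecialFibre (M.toTemperedCurve.ofOpenSubgroup (M.GtpXu l) (M.toThetaSetting.isOpen_GtpXu l) M.K (range_aug_GtpXu_eq_GK C) hDopen) d Sf h36 Sigma SigmaHat hsub hne hprime hp TpH HatH hle cuspMeetsH)),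
      IsHomeomorph A.eHat ∧
      (∀ x : T.Xplain,
        A.eHat ⟨(ofPiCHat e C μ hC hS hl hp2 hpl hζ hη hZ hN T).emb x, (ofPiCHat e C μ hC hS hl hp2 hpl hζ hη hZ hN T).emb_le_pmHat ⟨x, rfl⟩⟩ = (StableCurveTemperedData.ofSpecialFibre (M.toTemperedCurve.ofOpenSubgroup (M.GtpXu l) (M.toThetaSetting.isOpen_GtpXu l) M.K (range_aug_GtpXu_eq_GK C) hDopen) d Sf h36 Sigma SigmaHat hsub hne hprime hp TpH HatH hle cuspMeetsH).ιX (T.plainIso x)) ∧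
      (∀ (Q I : Subgroup (ofPiCHat e C μ hC hS hl hp2 hpl hζ hη hZ hN T).Corhat), Cu.IsCuspidalInertia Q I ↔
        I ≤ Q ∧ ∃ I₀, Cu.IsCuspidalInertia (ofPiCHat e C μ hC hS hl hp2 hpl hζ hη hZ hN T).piPM I₀ ∧ I = I₀ ⊓ Q) ∧
      A.PiSubgraphDictionary (((StableCurveTemperedData.ofSpecialFibre (M.toTemperedCurve.ofOpenSubgroup (M.GtpXu l) (M.toThetaSetting.isOpen_GtpXu l) M.K (range_aug_GtpXu_eq_GK C) hDopen) d Sf h36 Sigma SigmaHat hsub hne hprime hp TpH HatH hle cuspMeetsH).piTpXH.comap T.plainIso.toMulEquiv.toMonoidHom).comap T.incl) ∧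
      A.SubgraphDictionary (((StableCurveTemperedData.ofSpecialFibre (M.toTemperedCurve.ofOpenSubgroup (M.GtpXu l) (M.toThetaSetting.isOpen_GtpXu l) M.K (range_aug_GtpXu_eq_GK C) hDopen) d Sf h36 Sigma SigmaHat hsub hne hprime hp TpH HatH hle cuspMeetsH).piTpXH.comap T.plainIso.toMulEquiv.toMonoidHom).comap T.incl) := by
  obtain ⟨Cu, A, hhom, hA, hlev, hdic⟩ :=
    exists_stableCurveAgreement_piSubgraphDictionary_ofPiCHat_ofSpecialFibre e C μ hC hS hl hp2 hpl hζ hη hZ hN T hDopen d Sf h36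
      Sigma SigmaHat hsub hne hprime hp TpH HatH hle cuspMeetsH hHyp h23iv
  exact ⟨Cu, A, hhom, hA, hlev, hdic, StableCurveAgreement.SubgraphDictionary.of_pi A hdic hHyp h23iii⟩

/-- **[IUTchII] Cor 2.4 (i), proof p. 71 — hypothesis `h23v` of abc-iut-w4-d012's `cor24_i_of_inputs` AT THE GENUINE AGREEMENT, at `H▶`.**
From the Δ-level dictionary of `exists_stableCurveAgreement_subgraphDictionary_ofPiCHat_ofSpecialFibre` and [IUTchI] Cor 2.3 (ii), (v) of the
special-fibre datum BY NAME (abc-iut-L5's `Cor23ii`: the closure of `Δ^tp_{X,ℍ}` in `Δ̂_X` is `Δ̂_{X,ℍ}`; `Cor23v`: `Δ̂_{X,ℍ} ∩ Δ^tp_X = Δ^tp_{X,ℍ}`):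
for `γ' ∈ Δ^±_v = Π^±_v ∩ Δ̂^cor_v`, «`γ' ∈ Δ̂^±_{v▶}` [the closure] … hence `γ' ∈ Δ^±_{v▶} = Δ̂^±_{v▶} ∩ Δ^±_v` [cf. [IUTchI], Corollary 2.3, (v)]».
PROVED (∘ abc-iut-L6-t7's `StableCurveAgreement.h23v`).  HONEST LABEL: GENUINE on both sides modulo the binders named in the signature
(now also [IUTchI] Cor 2.3 (ii), (v) of the datum); nothing of the series is asserted; no side taken on [IUTchIII] Cor 3.12.
([IUTchII] Cor 2.4 (i), kurims pp.69–71; [IUTchI] Cor 2.3 (ii)(iii)(iv)(v), kurims pp.47–48) [claim: Mochizuki2012, status: disputed] -/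
theorem exists_stableCurveAgreement_h23v_ofPiCHat_ofSpecialFibre [(M.GtpXu l).FiniteIndex]
    [FiniteDimensional ℚ_[p] M.K]
    (hDopen : ∀ (x : M.toTemperedCurve.Pt) (g : M.toTemperedCurve.PiTemp),
      IsOpen (M.toTemperedCurve.aug '' ((M.toTemperedCurve.decompOfOpenAt (M.GtpXu l) x g).map (M.GtpXu l).subtype :
        Set M.toTemperedCurve.PiTemp)))
    (d : (M.toTemperedCurve.ofOpenSubgroup (M.GtpXu l) (M.toThetaSetting.isOpen_GtpXu l) M.K (range_aug_GtpXu_eq_GK C) hDopen).GroupLevelData)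
    (Sf : SpecialFibreData ((M.toTemperedCurve.ofOpenSubgroup (M.GtpXu l) (M.toThetaSetting.isOpen_GtpXu l) M.K (range_aug_GtpXu_eq_GK C) hDopen).toTemperedArithmeticGroup d))
    (h36 : Sf.Gc.Prop36Hypotheses) (Sigma SigmaHat : Set ℕ) (hsub : Sigma ⊆ SigmaHat) (hne : Sigma.Nonempty)
    (hprime : ∀ q ∈ SigmaHat, q.Prime) (hp : p ∉ Sigma) (TpH : Subgroup Sf.chart.G)
    (HatH : Subgroup (TemperedGraphGroupData.exists_completion_of_prop36 Sf.Gc h36 Sf.chart).choose)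
    (hle : TpH.map (TemperedGraphGroupData.exists_completion_of_prop36 Sf.Gc h36 Sf.chart).choose_spec.choose.toMonoidHom ≤ HatH)
    (cuspMeetsH : {x : (M.toTemperedCurve.ofOpenSubgroup (M.GtpXu l) (M.toThetaSetting.isOpen_GtpXu l) M.K (range_aug_GtpXu_eq_GK C) hDopen).Pt // (M.toTemperedCurve.ofOpenSubgroup (M.GtpXu l) (M.toThetaSetting.isOpen_GtpXu l) M.K (range_aug_GtpXu_eq_GK C) hDopen).IsCusp x} → Prop)
    (hHyp : (StableCurveTemperedData.ofSpecialFibre (M.toTemperedCurve.ofOpenSubgroup (M.GtpXu l) (M.toThetaSetting.isOpen_GtpXu l) M.K (range_aug_GtpXu_eq_GK C) hDopen) d Sf h36 Sigma SigmaHat hsub hne hprime hp TpH HatH hle cuspMeetsH).Cor23Hyp)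
    (h23ii : (StableCurveTemperedData.ofSpecialFibre (M.toTemperedCurve.ofOpenSubgroup (M.GtpXu l) (M.toThetaSetting.isOpen_GtpXu l) M.K (range_aug_GtpXu_eq_GK C) hDopen) d Sf h36 Sigma SigmaHat hsub hne hprime hp TpH HatH hle cuspMeetsH).Cor23ii)
    (h23iii : (StableCurveTemperedData.ofSpecialFibre (M.toTemperedCurve.ofOpenSubgroup (M.GtpXu l) (M.toThetaSetting.isOpen_GtpXu l) M.K (range_aug_GtpXu_eq_GK C) hDopen) d Sf h36 Sigma SigmaHat hsub hne hprime hp TpH HatH hle cuspMeetsH).Cor23iii)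
    (h23iv : (StableCurveTemperedData.ofSpecialFibre (M.toTemperedCurve.ofOpenSubgroup (M.GtpXu l) (M.toThetaSetting.isOpen_GtpXu l) M.K (range_aug_GtpXu_eq_GK C) hDopen) d Sf h36 Sigma SigmaHat hsub hne hprime hp TpH HatH hle cuspMeetsH).Cor23iv)
    (h23v : (StableCurveTemperedData.ofSpecialFibre (M.toTemperedCurve.ofOpenSubgroup (M.GtpXu l) (M.toThetaSetting.isOpen_GtpXu l) M.K (range_aug_GtpXu_eq_GK C) hDopen) d Sf h36 Sigma SigmaHat hsub hne hprime hp TpH HatH hle cuspMeetsH).Cor23v) :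
    ∃ (Cu : CuspidalInertiaData (ofPiCHat e C μ hC hS hl hp2 hpl hζ hη hZ hN T)) (A : StableCurveAgreement (ofPiCHat e C μ hC hS hl hp2 hpl hζ hη hZ hN T) Cu (StableCurveTemperedData.ofSpecialFibre (M.toTemperedCurve.ofOpenSubgroup (M.GtpXu l) (M.toThetaSetting.isOpen_GtpXu l) M.K (range_aug_GtpXu_eq_GK C) hDopen) d Sf h36 Sigma SigmaHat hsub hne hprime hp TpH HatH hle cuspMeetsH)),
      IsHomeomorph A.eHat ∧
      (∀ x : T.Xplain,
        A.eHat ⟨(ofPiCHat e C μ hC hS hl hp2 hpl hζ hη hZ hN T).emb x, (ofPiCHat e C μ hC hS hl hp2 hpl hζ hη hZ hN T).emb_le_pmHat ⟨x, rfl⟩⟩ = (StableCurveTemperedData.ofSpecialFibre (M.toTemperedCurve.ofOpenSubgroup (M.GtpXu l) (M.toThetaSetting.isOpen_GtpXu l) M.K (range_aug_GtpXu_eq_GK C) hDopen) d Sf h36 Sigma SigmaHat hsub hne hprime hp TpH HatH hle cuspMeetsH).ιX (T.plainIso x)) ∧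
      A.SubgraphDictionary (((StableCurveTemperedData.ofSpecialFibre (M.toTemperedCurve.ofOpenSubgroup (M.GtpXu l) (M.toThetaSetting.isOpen_GtpXu l) M.K (range_aug_GtpXu_eq_GK C) hDopen) d Sf h36 Sigma SigmaHat hsub hne hprime hp TpH HatH hle cuspMeetsH).piTpXH.comap T.plainIso.toMulEquiv.toMonoidHom).comap T.incl) ∧
      ∀ γ' : (ofPiCHat e C μ hC hS hl hp2 hpl hζ hη hZ hN T).Corhat,
        γ' ∈ (ofPiCHat e C μ hC hS hl hp2 hpl hζ hη hZ hN T).piPM ⊓ (ofPiCHat e C μ hC hS hl hp2 hpl hζ hη hZ hN T).aug.ker →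
          γ' ∈ closure ((ofPiCHat e C μ hC hS hl hp2 hpl hζ hη hZ hN T).deltaPmBox
              (((StableCurveTemperedData.ofSpecialFibre (M.toTemperedCurve.ofOpenSubgroup (M.GtpXu l) (M.toThetaSetting.isOpen_GtpXu l) M.K (range_aug_GtpXu_eq_GK C) hDopen) d Sf h36 Sigma SigmaHat hsub hne hprime hp TpH HatH hle cuspMeetsH).piTpXH.comap T.plainIso.toMulEquiv.toMonoidHom).comap T.incl) :
            Set (ofPiCHat e C μ hC hS hl hp2 hpl hζ hη hZ hN T).Corhat) →
          γ' ∈ (ofPiCHat e C μ hC hS hl hp2 hpl hζ hη hZ hN T).deltaPmBox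
              (((StableCurveTemperedData.ofSpecialFibre (M.toTemperedCurve.ofOpenSubgroup (M.GtpXu l) (M.toThetaSetting.isOpen_GtpXu l) M.K (range_aug_GtpXu_eq_GK C) hDopen) d Sf h36 Sigma SigmaHat hsub hne hprime hp TpH HatH hle cuspMeetsH).piTpXH.comap T.plainIso.toMulEquiv.toMonoidHom).comap T.incl) := by
  obtain ⟨Cu, A, hhom, hA, -, -, hdic⟩ :=
    exists_stableCurveAgreement_subgraphDictionary_ofPiCHat_ofSpecialFibre e C μ hC hS hl hp2 hpl hζ hη hZ hN T hDopen d Sf h36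
      Sigma SigmaHat hsub hne hprime hp TpH HatH hle cuspMeetsH hHyp h23iii h23iv
  exact ⟨Cu, A, hhom, hA, hdic, A.h23v hdic h23ii h23v⟩

end Genuine

end PlusMinusTower

end Literature.IUT.HodgeArakelov

end
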